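import Summits.ABC.ABC.Theorems.IsogenyGlueCongruenceEllipticGluingPrimeBoundOfSlices
import Summits.ABC.ABC.Theorems.IsogenyGlueCongruenceEllipticGluingPrimeBoundCMUniform
import HarnessLib

/-!
# Crux U `EllipticGluingPrimeBound` (stmt-ABC-13919), line `SketchIdeator5` — the summary theorem
# after the CM reshape: U ⟺ (R_gen ∧ R_cm^unif) modulo the shared apex inputs

Registered stub `stub_iffUniformResiduals` of skeleton v9 (lead c6).  Line `SketchIdeator5` had
reduced the crux U to the conjunction of two residual cores R_gen (generic, non-CM curves with
surjective mod-`ℓ` image and partners over whose endomorphism field the congruence is full) and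
R_cm (CM curves), modulo the route's shared apex inputs
(`ellipticGluingPrimeBound_iff_slices_of_cor44_of_gaudronRemond`, p126491).  Lead c6 showed that the
CM core is equivalent to its height-free, fully UNIFORM form R_cm^unif (`ℓ ≤ C (dim A + 1)^κ`;
`cmUniformPartnerBound_iff_cmCurvePartnerBound`, p138450, through the CM height bound
`stub_cmHeightBound`).  This file records the resulting normal form of the crux:

* `stub_iffUniformResiduals` — **{Mazur 1978 Cor. 4.4, Gaudron–Rémond pairs, `FaltingsTate`} ⟹
  (U ⟺ R_gen ∧ R_cm^unif)**.  `→` is unconditional (`genericPartnerBound_of_ellipticGluingPrimeBound`,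
  p126295; `cmUniformPartnerBound_of_ellipticGluingPrimeBound`, p138450); `←` is
  `ellipticGluingPrimeBound_of_slices_of_cor44_of_gaudronRemond` (p126491) fed through
  `cmCurvePartnerBound_of_uniform` (p138450);
* `uniformResiduals_of_ellipticGluingPrimeBound` — the unconditional half on its own.

So every proof of U proves a Frey–Mazur-type statement (R_gen: partner-height-free torsion sharing
for non-CM curves, polynomial in `dim A · max(1, h_F W)`) AND a Serre-uniformity-type statement
(R_cm^unif: an ABSOLUTE polynomial-in-dimension bound for torsion sharing of the thirteen CM
classes), and conversely these two, with the route's apex inputs, prove U.  Conditional result in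
the `←` direction only (three named inputs as hypotheses); standard axioms; no definitions; no
`sorry`; lands `--supports stmt-ABC-13919`.
-/

noncomputable section

-- `Summit.<Summit>.<Problem>` is the mandated summit-side namespace (CONVENTIONS §2); for the
-- single-conjunct summit `ABC` the two coincide, so the duplicate `ABC.ABC` is deliberate.
set_option linter.dupNamespace false

namespace Summit.ABC.ABC.Theorems.GluingSlices

open CategoryTheory CategoryTheory.Limits AlgebraicGeometry
open Literature.AlgebraicGeometry.Motives
open Summit.ABC.ABC.Theses.IsogenyGlueCongruence
open Summit.ABC.ABC.Theorems.IsotypicMinkowski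
open Literature.NumberTheory.EllipticCurves Literature.NumberTheory.DiophantineGeometry

/-- **U ⟹ (R_gen ∧ R_cm^unif), unconditionally**: the crux implies both residual cores of line
`SketchIdeator5` in their final form — the generic core by `genericPartnerBound_of_ellipticGluingPrimeBound`
(p126295) and the uniform CM core by `cmUniformPartnerBound_of_ellipticGluingPrimeBound` (p138450). -/
theorem uniformResiduals_of_ellipticGluingPrimeBound (hU : EllipticGluingPrimeBound) :
    (∃ κ C : ℝ, 0 ≤ κ ∧ ∀ (W : WeierstrassCurve ℚ) [W.IsElliptic] (E A : AbelianVariety.{0} ℚ)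
      (e : E.geomPoints ≃+ W.geomPoints),
      (∀ (σ : Field.absoluteGaloisGroup ℚ) (P : E.geomPoints), e (σ • P) = σ • e P) →
      (∀ f : E.baseChange (AlgebraicClosure ℚ) ⟶ A.baseChange (AlgebraicClosure ℚ), f = 0) →
      AbelianVariety.IsSimple A → ¬ W.HasCM →
      ∀ ℓ : ℕ, ℓ.Prime → 5 ≤ ℓ → W.HasSurjectiveModNGaloisRep ℓ →
      (∀ g ∈ commutator (Multiplicative (AddAut (W.geomTorsion ℓ))),
        ∃ σ : Field.absoluteGaloisGroup ℚ,
          (∀ r : A.baseChange (AlgebraicClosure ℚ) ⟶ A.baseChange (AlgebraicClosure ℚ),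
            A.galConj (AlgebraicClosure ℚ) (Field.absoluteGaloisGroup.toAlgEquiv ℚ σ) r = r) ∧
          W.galoisRepTorsion ℓ σ = g) →
      (∃ ι : W.geomTorsion ℓ →+ A.geomPoints, Function.Injective ι ∧
        ∀ (σ : Field.absoluteGaloisGroup ℚ) (P : W.geomTorsion ℓ), ι (σ • P) = σ • ι P) →
        (ℓ : ℝ) ≤ C * (((A.dim : ℝ) + 1) * max 1 W.stableFaltingsHeight) ^ κ) ∧
    (∃ κ C : ℝ, 0 ≤ κ ∧ ∀ (W : WeierstrassCurve ℚ) [W.IsElliptic] (E A : AbelianVariety.{0} ℚ)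
      (e : E.geomPoints ≃+ W.geomPoints),
      (∀ (σ : Field.absoluteGaloisGroup ℚ) (P : E.geomPoints), e (σ • P) = σ • e P) →
      (∀ f : E.baseChange (AlgebraicClosure ℚ) ⟶ A.baseChange (AlgebraicClosure ℚ), f = 0) →
      AbelianVariety.IsSimple A →
      ∀ ℓ : ℕ, ℓ.Prime → W.HasIrreducibleModPGaloisRep ℓ → W.HasCM →
      (∃ ι : W.geomTorsion ℓ →+ A.geomPoints, Function.Injective ι ∧
        ∀ (σ : Field.absoluteGaloisGroup ℚ) (P : W.geomTorsion ℓ), ι (σ • P) = σ • ι P) →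
        (ℓ : ℝ) ≤ C * ((A.dim : ℝ) + 1) ^ κ) :=
  ⟨genericPartnerBound_of_ellipticGluingPrimeBound hU,
    cmUniformPartnerBound_of_ellipticGluingPrimeBound hU⟩

/-- **Registered stub `stub_iffUniformResiduals` (skeleton v9 of line `SketchIdeator5`):
{Mazur 1978 Cor. 4.4, Gaudron–Rémond pairs, `FaltingsTate`} ⟹ (U ⟺ R_gen ∧ R_cm^unif).**
`→`: `uniformResiduals_of_ellipticGluingPrimeBound` (unconditional); `←`:
`ellipticGluingPrimeBound_of_slices_of_cor44_of_gaudronRemond` (p126491) with the uniform CM core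
converted to its `h`-form by `cmCurvePartnerBound_of_uniform` (p138450).  Conditional result
(three named inputs as hypotheses, used only in `←`). -/
theorem stub_iffUniformResiduals :
    Mazur1978.cor44_valuation_j_le_one → GaudronRemond2023_torsionHom_ellipticPair → FaltingsTate →
    (EllipticGluingPrimeBound ↔
      ((∃ κ C : ℝ, 0 ≤ κ ∧ ∀ (W : WeierstrassCurve ℚ) [W.IsElliptic] (E A : AbelianVariety.{0} ℚ)
      (e : E.geomPoints ≃+ W.geomPoints),
      (∀ (σ : Field.absoluteGaloisGroup ℚ) (P : E.geomPoints), e (σ • P) = σ • e P) →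
      (∀ f : E.baseChange (AlgebraicClosure ℚ) ⟶ A.baseChange (AlgebraicClosure ℚ), f = 0) →
      AbelianVariety.IsSimple A → ¬ W.HasCM →
      ∀ ℓ : ℕ, ℓ.Prime → 5 ≤ ℓ → W.HasSurjectiveModNGaloisRep ℓ →
      (∀ g ∈ commutator (Multiplicative (AddAut (W.geomTorsion ℓ))),
        ∃ σ : Field.absoluteGaloisGroup ℚ,
          (∀ r : A.baseChange (AlgebraicClosure ℚ) ⟶ A.baseChange (AlgebraicClosure ℚ),
            A.galConj (AlgebraicClosure ℚ) (Field.absoluteGaloisGroup.toAlgEquiv ℚ σ) r = r) ∧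
          W.galoisRepTorsion ℓ σ = g) →
      (∃ ι : W.geomTorsion ℓ →+ A.geomPoints, Function.Injective ι ∧
        ∀ (σ : Field.absoluteGaloisGroup ℚ) (P : W.geomTorsion ℓ), ι (σ • P) = σ • ι P) →
        (ℓ : ℝ) ≤ C * (((A.dim : ℝ) + 1) * max 1 W.stableFaltingsHeight) ^ κ) ∧
      (∃ κ C : ℝ, 0 ≤ κ ∧ ∀ (W : WeierstrassCurve ℚ) [W.IsElliptic] (E A : AbelianVariety.{0} ℚ)
      (e : E.geomPoints ≃+ W.geomPoints),
      (∀ (σ : Field.absoluteGaloisGroup ℚ) (P : E.geomPoints), e (σ • P) = σ • e P) →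
      (∀ f : E.baseChange (AlgebraicClosure ℚ) ⟶ A.baseChange (AlgebraicClosure ℚ), f = 0) →
      AbelianVariety.IsSimple A →
      ∀ ℓ : ℕ, ℓ.Prime → W.HasIrreducibleModPGaloisRep ℓ → W.HasCM →
      (∃ ι : W.geomTorsion ℓ →+ A.geomPoints, Function.Injective ι ∧
        ∀ (σ : Field.absoluteGaloisGroup ℚ) (P : W.geomTorsion ℓ), ι (σ • P) = σ • ι P) →
        (ℓ : ℝ) ≤ C * ((A.dim : ℝ) + 1) ^ κ))) :=
  fun h44 hGR hFal ↦ ⟨uniformResiduals_of_ellipticGluingPrimeBound,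
    fun h ↦ ellipticGluingPrimeBound_of_slices_of_cor44_of_gaudronRemond h44 hGR hFal h.1
      (cmCurvePartnerBound_of_uniform h.2)⟩

end Summit.ABC.ABC.Theorems.GluingSlices

end
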